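import Literature.IUT.HodgeTheaters.PadicFrobenioidTMPairFixedField
import Mathlib.NumberTheory.Padics.PadicNumbers
import HarnessLib

/-!
# Two-sided integrality of the [FrdII] Thm 2.4 (ii) pair is AUTOMATIC: a group isomorphism `ψ̄ : ℚ̄_{p₁}^× ⥲ ℚ̄_{p₂}^×` carrying integers into
# integers carries integers EXACTLY onto integers — residual «C53ii/N3b CONVERSE-INTEGRALITY» of `PadicFrobenioidTMPairAdapter` DISCHARGED,
# and the full chain «abc-iut-L1's pair ⇒ [AbsTopIII] Prop 3.2 (iv) rigidity on `𝒪^⊳`» stated in abc-iut-L1's literal conclusion shape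
# (cell abc-iut, L5 hub node IUTchI:Cor5.3(ii), SUBDAG-IUTchI-Cor53 v1.1; PROOF-ONLY, no definitions)

S. Mochizuki, *The geometry of Frobenioids II*, Thm 2.4 (i) p. 20 l. 21–27 («`Ψ` preserves `O^▷(−)`») and (ii) p. 21 («`Ψ` induces a pair of
compatible isomorphisms `G₁ ⥲ G₂`; `K̄₁^× ⥲ K̄₂^×`») [cite: MochizukiFrdII2008, Thm 2.4 (ii) p.21]; S. Mochizuki, *Topics in absolute anabelian
geometry III*, Prop 3.2 (iv) p. 72 («induces an injection `Isom((Π ↷ M_T), (Π* ↷ M*_T)) ↪ Isom_TG(Π, Π*)`») [cite: MochizukiAbsTopIII2015,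
Proposition 3.2 (iv) p.72]; S. Mochizuki, *Inter-universal Teichmüller theory I*, proof of Cor 5.3 (ii) p. 144 l. 36–39
([IUTchI] Cor 5.3 (ii) p.144) [claim: Mochizuki2012, status: disputed] (claim key; elementary valuation theory + OUR interfaces; nothing of the series is
asserted, no side is taken on [IUTchIII] Cor. 3.12).

## What this file proves (sequel to p490952 / p493397, abc-iut-w4-d077)

abc-iut-L1's `exists_pairIso_fbarUnits_integral` delivers the pair `(φ, ψ̄)` with ONE-SIDED integrality `‖a‖ ≤ 1 ⇒ ‖ψ̄ a‖ ≤ 1` (from print's «`Ψ`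
preserves `O^▷(−)`»), while `PadicTMPair.tmPairIsoOfPair` (p490952) displays TWO-SIDED integrality `hint`.  The converse is AUTOMATIC, by an
elementary archimedean argument on the absolute value (no Galois equivariance, no class field theory):

* `units_norm_map_eq_one_of_norm_eq_one` — a group isomorphism `ψ : K₁^× ⥲ K₂^×` of the unit groups of two normed division rings carrying
  `{‖·‖ ≤ 1}` into `{‖·‖ ≤ 1}` carries `{‖·‖ = 1}` into `{‖·‖ = 1}` (apply the hypothesis to `u` and `u⁻¹`);
* `units_norm_le_one_iff_of_forall_norm_le_one` — and, as soon as `K₂` has an element of absolute value `< 1`, it carries `{‖·‖ ≤ 1}` EXACTLY onto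
  `{‖·‖ ≤ 1}`: if `‖a‖ > 1` but `‖ψ a‖ ≤ 1` then `‖ψ a‖ = 1` (by `a⁻¹`), every `x` satisfies `‖x‖ ≤ ‖a‖ⁿ` for some `n` (archimedean), so
  `‖ψ x‖ ≤ ‖ψ a‖ⁿ = 1`, and symmetrically `‖ψ x‖ ≥ 1`; so `ψ` lands in `{‖·‖ = 1}`, contradicting surjectivity onto an element of absolute value `< 1`;
* `PadicTMPair.exists_units_norm_lt_one` (`‖p‖ = p⁻¹ < 1` in `ℚ̄_p`) and **`PadicTMPair.hint_of_oneSided`** — the displayed `hint` of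
  `tmPairIsoOfPair` in its exact shape, from abc-iut-L1's one-sided conclusion;
* **`PadicTMPair.psibar_apply_eq_of_galois_eq_of_rangeEquiv`** — THE WHOLE CHAIN in abc-iut-L1's literal conclusion shape: over two genuine §2 bases
  (`IsOpenHom φᵢ`), two [FrdII] Thm 2.4 (ii) pairs `(φ, ψ, ψ̄)`, `(φ, ψ′, ψ̄′)` over the SAME `φ : Π₁ ≃ₜ* Π₂` — each with abc-iut-L1's `hψ`, `hequiv`
  and ONE-SIDED integrality — agree on every `p₁`-adic integer: `ψ̄ = ψ̄′` on `𝒪^⊳_{ℚ̄_{p₁}}` ([AbsTopIII] Prop 3.2 (iv) through p490952's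
  `tmPairIso_isoM_eq_of_isoPi_eq`, the `.TM` inputs from p493397's `isMLFGaloisMonoidPair_tmPairOfGaloisHom`, `hint` from this file,
  `hequiv` from p490952's `hequiv_of_rangeEquiv`).  NO displayed binder remains beyond abc-iut-L1's own conclusion conjuncts.

Theorems only; nothing of L1/L4 restated; typed ≠ proved elsewhere; binder ≠ fact.
-/

noncomputable section

namespace Literature.IUT.HodgeTheaters

open Literature.AlgebraicGeometry.Frobenioids Literature.AlgebraicGeometry.Frobenioids.QuasiTemperoid
open Literature.AnabelianGeometry.AbsoluteAnabelian

namespace PadicTMPair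

/-! ### §1. Elementary: one-sided integrality of a group isomorphism of unit groups is two-sided -/

section UnitsNorm

variable {K₁ K₂ : Type*} [NormedDivisionRing K₁] [NormedDivisionRing K₂] (ψ : K₁ˣ ≃* K₂ˣ)
  (h : ∀ u : K₁ˣ, ‖(u : K₁)‖ ≤ 1 → ‖((ψ u : K₂ˣ) : K₂)‖ ≤ 1)

include h in
/-- A group isomorphism of unit groups carrying `{‖·‖ ≤ 1}` into `{‖·‖ ≤ 1}` carries `{‖·‖ = 1}` into `{‖·‖ = 1}` (apply the hypothesis to `u` and
to `u⁻¹`). [cite: MochizukiFrdII2008, Thm 2.4 (ii) p.21] -/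
theorem units_norm_map_eq_one_of_norm_eq_one {u : K₁ˣ} (hu : ‖(u : K₁)‖ = 1) : ‖((ψ u : K₂ˣ) : K₂)‖ = 1 := by
  apply le_antisymm (h u hu.le)
  have h1 : ‖((ψ u⁻¹ : K₂ˣ) : K₂)‖ ≤ 1 := h u⁻¹ (by rw [Units.val_inv_eq_inv_val, norm_inv, hu, inv_one])
  rw [map_inv, Units.val_inv_eq_inv_val, norm_inv] at h1
  exact (inv_le_one₀ (norm_pos_iff.mpr (ψ u).ne_zero)).mp h1

include h in
/-- If `‖ψ a‖ ≤ 1` for some `a` with `‖a‖ > 1`, then `ψ` lands in `{‖·‖ = 1}`: `‖ψ a‖ = 1` (by `a⁻¹`), and every `x` has `‖x‖ ≤ ‖a‖ⁿ` for some `n`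
(archimedean property of `ℝ`), so `x · a⁻ⁿ` and `x⁻¹ · a⁻ᵐ` are "integral", forcing `‖ψ x‖ = 1`. [cite: MochizukiFrdII2008, Thm 2.4 (ii) p.21] -/
theorem units_norm_map_eq_one_of_one_lt_norm {a : K₁ˣ} (ha : 1 < ‖(a : K₁)‖) (hψa : ‖((ψ a : K₂ˣ) : K₂)‖ ≤ 1) (x : K₁ˣ) :
    ‖((ψ x : K₂ˣ) : K₂)‖ = 1 := by
  -- `‖ψ a‖ = 1`
  have hinv : ‖((a⁻¹ : K₁ˣ) : K₁)‖ ≤ 1 := by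
    rw [Units.val_inv_eq_inv_val, norm_inv]
    exact inv_le_one_of_one_le₀ ha.le
  have h1 : 1 ≤ ‖((ψ a : K₂ˣ) : K₂)‖ := by
    have h2 := h a⁻¹ hinv
    rw [map_inv, Units.val_inv_eq_inv_val, norm_inv] at h2
    exact (inv_le_one₀ (norm_pos_iff.mpr (ψ a).ne_zero)).mp h2
  have heq : ‖((ψ a : K₂ˣ) : K₂)‖ = 1 := le_antisymm hψa h1
  -- every `x` maps into `{‖·‖ ≤ 1}`
  have hall : ∀ y : K₁ˣ, ‖((ψ y : K₂ˣ) : K₂)‖ ≤ 1 := by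
    intro y
    obtain ⟨n, hn⟩ := pow_unbounded_of_one_lt ‖(y : K₁)‖ ha
    have hpos : 0 < ‖(a : K₁)‖ ^ n := pow_pos (norm_pos_iff.mpr a.ne_zero) n
    have hya : ‖((y * (a ^ n)⁻¹ : K₁ˣ) : K₁)‖ ≤ 1 := by
      rw [Units.val_mul, Units.val_inv_eq_inv_val, Units.val_pow_eq_pow_val, norm_mul, norm_inv, norm_pow,
        mul_inv_le_iff₀ hpos, one_mul]
      exact hn.le
    have h3 := h _ hya
    rw [map_mul, map_inv, map_pow, Units.val_mul, Units.val_inv_eq_inv_val, Units.val_pow_eq_pow_val, norm_mul, norm_inv,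
      norm_pow, heq, one_pow, inv_one, mul_one] at h3
    exact h3
  apply le_antisymm (hall x)
  have h4 := hall x⁻¹
  rw [map_inv, Units.val_inv_eq_inv_val, norm_inv] at h4
  exact (inv_le_one₀ (norm_pos_iff.mpr (ψ x).ne_zero)).mp h4

include h in
/-- **One-sided integrality is two-sided**: a group isomorphism `ψ : K₁^× ⥲ K₂^×` carrying `{‖·‖ ≤ 1}` into `{‖·‖ ≤ 1}` carries it EXACTLY onto
`{‖·‖ ≤ 1}`, provided `K₂` has an element of absolute value `< 1` (else `ψ` would land in `{‖·‖ = 1}`, by `units_norm_map_eq_one_of_one_lt_norm`,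
contradicting surjectivity). [cite: MochizukiFrdII2008, Thm 2.4 (ii) p.21] -/
theorem units_norm_le_one_iff_of_forall_norm_le_one (hK₂ : ∃ y : K₂ˣ, ‖(y : K₂)‖ < 1) (u : K₁ˣ) :
    ‖(u : K₁)‖ ≤ 1 ↔ ‖((ψ u : K₂ˣ) : K₂)‖ ≤ 1 := by
  refine ⟨h u, fun hψu => ?_⟩
  by_contra hu
  rw [not_le] at hu
  obtain ⟨y, hy⟩ := hK₂
  have h1 := units_norm_map_eq_one_of_one_lt_norm ψ h hu hψu (ψ.symm y)
  rw [MulEquiv.apply_symm_apply] at h1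
  exact absurd h1 (ne_of_lt hy)

end UnitsNorm

/-! ### §2. `ℚ̄_p` has elements of absolute value `< 1`; the displayed `hint` of `tmPairIsoOfPair` from one-sided integrality -/

/-- `‖p‖ = p⁻¹ < 1` in `ℚ̄_p`: the unit group of `ℚ̄_p` has an element of absolute value `< 1`. [cite: MochizukiFrdII2008, Ex 1.1 (i) p.7] -/
theorem exists_units_norm_lt_one (p : ℕ) [Fact p.Prime] :
    ∃ y : (Fbar ℚ_[p])ˣ, ‖(show PadicAlgCl p from (y : Fbar ℚ_[p]))‖ < 1 := by
  have hp0 : ((p : ℚ_[p]) : PadicAlgCl p) ≠ 0 := by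
    rw [map_natCast]
    exact Nat.cast_ne_zero.mpr (Fact.out : p.Prime).ne_zero
  refine ⟨Units.mk0 (show Fbar ℚ_[p] from ((p : ℚ_[p]) : PadicAlgCl p)) hp0, ?_⟩
  change ‖((p : ℚ_[p]) : PadicAlgCl p)‖ < 1
  rw [PadicAlgCl.norm_extends, Padic.norm_p]
  exact inv_lt_one_of_one_lt₀ (by exact_mod_cast (Fact.out : p.Prime).one_lt)

/-- **Residual «N3b CONVERSE-INTEGRALITY» DISCHARGED — the displayed `hint` of `tmPairIsoOfPair` (p490952) in its exact shape, from abc-iut-L1's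
ONE-SIDED conclusion** `‖a‖ ≤ 1 ⇒ ‖ψ̄ a‖ ≤ 1` of `exists_pairIso_fbarUnits_integral` («`Ψ` preserves `O^▷(−)`»): a group isomorphism
`ψ̄ : ℚ̄_{p₁}^× ⥲ ℚ̄_{p₂}^×` carrying `p₁`-adic integers into `p₂`-adic integers carries them EXACTLY onto the `p₂`-adic integers.
[cite: MochizukiFrdII2008, Thm 2.4 (ii) p.21] -/
theorem hint_of_oneSided {p₁ p₂ : ℕ} [Fact p₁.Prime] [Fact p₂.Prime] (ψbar : (Fbar ℚ_[p₁])ˣ ≃* (Fbar ℚ_[p₂])ˣ)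
    (h : ∀ u : (Fbar ℚ_[p₁])ˣ, ‖(show PadicAlgCl p₁ from (u : Fbar ℚ_[p₁]))‖ ≤ 1 →
      ‖(show PadicAlgCl p₂ from ((ψbar u : (Fbar ℚ_[p₂])ˣ) : Fbar ℚ_[p₂]))‖ ≤ 1)
    (u : (Fbar ℚ_[p₁])ˣ) :
    ‖(show PadicAlgCl p₁ from (u : Fbar ℚ_[p₁]))‖ ≤ 1 ↔ ‖(show PadicAlgCl p₂ from ((ψbar u : (Fbar ℚ_[p₂])ˣ) : Fbar ℚ_[p₂]))‖ ≤ 1 :=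
  units_norm_le_one_iff_of_forall_norm_le_one (K₁ := PadicAlgCl p₁) (K₂ := PadicAlgCl p₂) ψbar h (exists_units_norm_lt_one p₂) u

/-! ### §3. The whole chain in abc-iut-L1's literal conclusion shape -/

section Chain

variable {p₁ p₂ : ℕ} [Fact p₁.Prime] [Fact p₂.Prime]
  {G : Type} [Group G] [TopologicalSpace G] [IsTopologicalGroup G]
  {G₂ : Type} [Group G₂] [TopologicalSpace G₂] [IsTopologicalGroup G₂]
  (φ₁ : G →* GalFbar ℚ_[p₁]) (hφ₁ : IsOpenHom φ₁) (φ₂ : G₂ →* GalFbar ℚ_[p₂]) (hφ₂ : IsOpenHom φ₂)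

/-- **From abc-iut-L1's pair to the `TM`-pair isomorphism, no binder**: a [FrdII] Thm 2.4 (ii) pair `(φ, ψ, ψ̄)` over genuine §2 bases in the
literal conclusion shape of `exists_pairIso_fbarUnits_integral` (`hψ`, `hequiv`, ONE-SIDED integrality) IS an isomorphism of MLF-Galois
`TM`-pairs `(Π₁ ↷ 𝒪^⊳_{ℚ̄_{p₁}}) ⥲ (Π₂ ↷ 𝒪^⊳_{ℚ̄_{p₂}})` with Galois component `φ` and monoid component `ψ̄|_{𝒪^⊳}`.
[cite: MochizukiAbsTopIII2015, Definition 3.1 (ii) p.67] -/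
theorem exists_tmPairIso_of_rangePair (φ : G ≃ₜ* G₂) (ψ : φ₁.range ≃ₜ* φ₂.range) (ψbar : (Fbar ℚ_[p₁])ˣ ≃* (Fbar ℚ_[p₂])ˣ)
    (hψ : ∀ g : G, ((ψ ⟨φ₁ g, ⟨g, rfl⟩⟩ : φ₂.range) : GalFbar ℚ_[p₂]) = φ₂ (φ g))
    (hequiv : ∀ (σ : φ₁.range) (u : (Fbar ℚ_[p₁])ˣ),
      ψbar (Units.map ((σ : GalFbar ℚ_[p₁]) : Fbar ℚ_[p₁] →* Fbar ℚ_[p₁]) u) =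
        Units.map (((ψ σ : φ₂.range) : GalFbar ℚ_[p₂]) : Fbar ℚ_[p₂] →* Fbar ℚ_[p₂]) (ψbar u))
    (hint : ∀ u : (Fbar ℚ_[p₁])ˣ, ‖(show PadicAlgCl p₁ from (u : Fbar ℚ_[p₁]))‖ ≤ 1 →
      ‖(show PadicAlgCl p₂ from ((ψbar u : (Fbar ℚ_[p₂])ˣ) : Fbar ℚ_[p₂]))‖ ≤ 1) :
    ∃ e : GaloisMonoidPair.Iso (tmPairOfGaloisHom φ₁ (IsOpenHom.continuous hφ₁)) (tmPairOfGaloisHom φ₂ (IsOpenHom.continuous hφ₂)),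
      e.isoPi = φ ∧ ∀ x : ↥(nonzeroIntegers ℚ_[p₁] (Fbar ℚ_[p₁])),
        ((show ↥(nonzeroIntegers ℚ_[p₂] (Fbar ℚ_[p₂])) from e.isoM x) : Fbar ℚ_[p₂]) =
          ((ψbar (ModelMLFGaloisData.toUnit x) : (Fbar ℚ_[p₂])ˣ) : Fbar ℚ_[p₂]) :=
  ⟨tmPairIsoOfPair φ₁ (IsOpenHom.continuous hφ₁) φ₂ (IsOpenHom.continuous hφ₂) φ ψbar (hint_of_oneSided ψbar hint)
      (hequiv_of_rangeEquiv φ₁ φ₂ φ ψ ψbar hψ hequiv),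
    rfl, fun _ => rfl⟩

include hφ₁ hφ₂ in
/-- **THE CHAIN «abc-iut-L1's [FrdII] Thm 2.4 (ii) pair ⇒ [AbsTopIII] Prop 3.2 (iv) rigidity», every hypothesis in abc-iut-L1's literal conclusion shape
and NO displayed binder beyond them**: over two genuine §2 bases (`φᵢ : Πᵢ → G_{ℚ_{pᵢ}}` open homomorphisms), two pairs `(φ, ψ, ψ̄)` and
`(φ, ψ′, ψ̄′)` over the SAME Galois component `φ : Π₁ ≃ₜ* Π₂`, each with abc-iut-L1's `hψ` (`ψ(φ₁ g) = φ₂(φ g)`), `hequiv`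
(`ψ̄(σ·u) = ψ(σ)·ψ̄(u)`) and ONE-SIDED integrality (`‖a‖ ≤ 1 ⇒ ‖ψ̄ a‖ ≤ 1`), AGREE ON EVERY `p₁`-ADIC INTEGER: `ψ̄ = ψ̄′` on `𝒪^⊳_{ℚ̄_{p₁}}`
(p490952 `psibar_apply_eq_of_galois_eq` + p493397 `isMLFGaloisMonoidPair_tmPairOfGaloisHom` + `hint_of_oneSided` + `hequiv_of_rangeEquiv`).  This is
the Frobenioid-base form of the injectivity that [IUTchI] Cor 5.3 (ii)'s clause (b) invokes. ([IUTchI] Cor 5.3 (ii) p.144) [claim: Mochizuki2012, status: disputed] -/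
theorem psibar_apply_eq_of_galois_eq_of_rangeEquiv (φ : G ≃ₜ* G₂)
    (ψ : φ₁.range ≃ₜ* φ₂.range) (ψbar : (Fbar ℚ_[p₁])ˣ ≃* (Fbar ℚ_[p₂])ˣ)
    (hψ : ∀ g : G, ((ψ ⟨φ₁ g, ⟨g, rfl⟩⟩ : φ₂.range) : GalFbar ℚ_[p₂]) = φ₂ (φ g))
    (hequiv : ∀ (σ : φ₁.range) (u : (Fbar ℚ_[p₁])ˣ),
      ψbar (Units.map ((σ : GalFbar ℚ_[p₁]) : Fbar ℚ_[p₁] →* Fbar ℚ_[p₁]) u) =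
        Units.map (((ψ σ : φ₂.range) : GalFbar ℚ_[p₂]) : Fbar ℚ_[p₂] →* Fbar ℚ_[p₂]) (ψbar u))
    (hint : ∀ u : (Fbar ℚ_[p₁])ˣ, ‖(show PadicAlgCl p₁ from (u : Fbar ℚ_[p₁]))‖ ≤ 1 →
      ‖(show PadicAlgCl p₂ from ((ψbar u : (Fbar ℚ_[p₂])ˣ) : Fbar ℚ_[p₂]))‖ ≤ 1)
    (ψ' : φ₁.range ≃ₜ* φ₂.range) (ψbar' : (Fbar ℚ_[p₁])ˣ ≃* (Fbar ℚ_[p₂])ˣ)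
    (hψ' : ∀ g : G, ((ψ' ⟨φ₁ g, ⟨g, rfl⟩⟩ : φ₂.range) : GalFbar ℚ_[p₂]) = φ₂ (φ g))
    (hequiv' : ∀ (σ : φ₁.range) (u : (Fbar ℚ_[p₁])ˣ),
      ψbar' (Units.map ((σ : GalFbar ℚ_[p₁]) : Fbar ℚ_[p₁] →* Fbar ℚ_[p₁]) u) =
        Units.map (((ψ' σ : φ₂.range) : GalFbar ℚ_[p₂]) : Fbar ℚ_[p₂] →* Fbar ℚ_[p₂]) (ψbar' u))
    (hint' : ∀ u : (Fbar ℚ_[p₁])ˣ, ‖(show PadicAlgCl p₁ from (u : Fbar ℚ_[p₁]))‖ ≤ 1 →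
      ‖(show PadicAlgCl p₂ from ((ψbar' u : (Fbar ℚ_[p₂])ˣ) : Fbar ℚ_[p₂]))‖ ≤ 1)
    (x : ↥(nonzeroIntegers ℚ_[p₁] (Fbar ℚ_[p₁]))) :
    ψbar (ModelMLFGaloisData.toUnit x) = ψbar' (ModelMLFGaloisData.toUnit x) :=
  psibar_apply_eq_of_galois_eq_of_isOpenHom φ₁ hφ₁ φ₂ hφ₂ φ ψbar (hint_of_oneSided ψbar hint)
    (hequiv_of_rangeEquiv φ₁ φ₂ φ ψ ψbar hψ hequiv) ψbar' (hint_of_oneSided ψbar' hint')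
    (hequiv_of_rangeEquiv φ₁ φ₂ φ ψ' ψbar' hψ' hequiv') x

end Chain

end PadicTMPair

end Literature.IUT.HodgeTheaters
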